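import Summits.BirchSwinnertonDyer.Rank1Residual.Partition.Rows
import Literature.NumberTheory.EllipticCurves.Rank1Residual.X9SmallImage
import Literature.NumberTheory.EllipticCurves.SupersingularIrreducibleProofs
import Literature.NumberTheory.EllipticCurves.NonEisensteinPrimeOfSurjective
import HarnessLib

/-!
# Partition lemma, part 4/5: the atom lemmas — each bit of `cellOf W p` is the tree predicate — and consistency

HONEST FRAMING (cell `b2b-bsdres`, run/shared/lean/b2b/bsd-rank1-residual/, verbatim in every
file): the goal of the cell is to DELETE the COMBINATION-SHAPED residual classes of the
Birch–Swinnerton-Dyer formula for ALL analytic-rank `≤ 1` elliptic curves over `ℚ` — "full BSD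
formula for every rank `≤ 1` curve in class `C`" assembled STRICTLY from published theorems — so
that the rank-`≤ 1` remainder becomes exactly the CONSTRUCTION-SHAPED classes, which are TYPED
(missing-input `Prop`s), NOT attempted. This is not "finishing BSD".

Theorems only. `cellOf_*`: each Boolean atom of the cell of `(E, p)` (part 3) is equivalent to the
corresponding predicate of `Literature/…/Rank1Residual/Predicates.lean` (`GoodOrd`, `Mult`, `Irr`,
`Surj`, `Ram`, `Anom`, `GVPar`, `BigIm`, `Semistable`, `HasCM`, `CMSplit`, `CMRamified`,
`analyticRank = 0 / 1`, `p = 2 / = 3 / ≥ 5`, …); `cellOf_consistent`: the cell of a real pair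
satisfies the four consistency constraints of the grid — anom ⇒ red ∧ ord (`goodOrd_of_anom`),
red ∧ good ∧ `p > 2` ⇒ ord (`goodOrd_of_red_of_good`, Serre 1972 §1.11 Prop. 12), additive ⇒ not
semistable (definition), irr ∧ ¬surj ⇒ ¬(im) (x9 seat's `not_bigIm_of_irr_of_not_surj`). Also the
inclusions `ClassX9 → ClassX9im`, `ClassX11a → ClassX11`, `ClassX11 ∧ r = 1 → ClassX11b`.
-/

namespace Summit.BirchSwinnertonDyer.Rank1Residual

open WeierstrassCurve Literature.NumberTheory.EllipticCurves
  Literature.NumberTheory.EllipticCurves.Rank1Residual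

section Curve

open scoped Classical

variable (W : WeierstrassCurve ℚ) [W.IsElliptic] [W.IsGloballyMinimal] (p : ℕ) [Fact p.Prime]

omit [W.IsElliptic] [W.IsGloballyMinimal] in
/-- For a prime, `p ≠ 2 ↔ 2 < p`. [folklore] -/
theorem prime_ne_two_iff : p ≠ 2 ↔ 2 < p := by
  have h2 := (Fact.out : p.Prime).two_le
  omega

/-- `isTwo` ↔ `p = 2`. [folklore] -/
theorem cellOf_isTwo : (cellOf W p).isTwo = true ↔ p = 2 := by
  simp only [Cell.isTwo, cellOf, pkOf, beq_iff_eq]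
  by_cases h2 : p = 2
  · simp [h2]
  · by_cases h3 : p = 3
    · simp [h3]
    · simp [h2, h3]

/-- `odd` ↔ `p ≠ 2`. [folklore] -/
theorem cellOf_odd : (cellOf W p).odd = true ↔ p ≠ 2 := by
  simp only [Cell.odd, cellOf, pkOf, bne_iff_ne, ne_eq]
  by_cases h2 : p = 2
  · simp [h2]
  · by_cases h3 : p = 3
    · simp [h3]
    · simp [h2, h3]

/-- `gt2` ↔ `2 < p`. [folklore] -/
theorem cellOf_gt2 : (cellOf W p).gt2 = true ↔ 2 < p := by
  rw [← prime_ne_two_iff]; exact cellOf_odd W p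

/-- `ge3` ↔ `3 ≤ p`. [folklore] -/
theorem cellOf_ge3 : (cellOf W p).ge3 = true ↔ 3 ≤ p := by
  rw [show (3 ≤ p ↔ 2 < p) from Iff.rfl, ← prime_ne_two_iff]; exact cellOf_odd W p

/-- `isThree` ↔ `p = 3`. [folklore] -/
theorem cellOf_isThree : (cellOf W p).isThree = true ↔ p = 3 := by
  simp only [Cell.isThree, cellOf, pkOf, beq_iff_eq]
  by_cases h2 : p = 2
  · simp [h2]
  · by_cases h3 : p = 3
    · simp [h3]
    · simp [h2, h3]

/-- `ge5` ↔ `5 ≤ p`. [folklore] -/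
theorem cellOf_ge5 : (cellOf W p).ge5 = true ↔ 5 ≤ p := by
  simp only [Cell.ge5, cellOf, pkOf, beq_iff_eq]
  by_cases h2 : p = 2
  · simp [h2]
  · by_cases h3 : p = 3
    · simp [h3]
    · simp only [h2, h3, if_false, true_iff]
      exact (Fact.out : p.Prime).five_le_of_ne_two_of_ne_three h2 h3

/-- `gt3` ↔ `3 < p`. [folklore] -/
theorem cellOf_gt3 : (cellOf W p).gt3 = true ↔ 3 < p := by
  have h : (cellOf W p).gt3 = true ↔ 5 ≤ p := cellOf_ge5 W p
  rw [h]
  constructor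
  · intro h5; omega
  · intro h3
    by_contra h5
    have h4 : p = 4 := by omega
    exact absurd (Fact.out : p.Prime) (by rw [h4]; norm_num)

/-- `goodOrd` ↔ ord(p). [folklore] -/
theorem cellOf_goodOrd : (cellOf W p).goodOrd = true ↔ GoodOrd W p := by
  simp only [Cell.goodOrd, cellOf, redOf, beq_iff_eq, GoodOrd]
  by_cases hg : Good W p
  · by_cases hss : (p : ℤ) ∣ W.frobeniusTrace p
    · simp [hg, hss]
    · simp [hg, hss]
  · by_cases hm : Mult W p
    · simp [hg, hm]
    · simp [hg, hm]

/-- `goodSS` ↔ ss(p). [folklore] -/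
theorem cellOf_goodSS : (cellOf W p).goodSS = true ↔ GoodSS W p := by
  simp only [Cell.goodSS, cellOf, redOf, beq_iff_eq, GoodSS]
  by_cases hg : Good W p
  · by_cases hss : (p : ℤ) ∣ W.frobeniusTrace p
    · simp [hg, hss]
    · simp [hg, hss]
  · by_cases hm : Mult W p
    · simp [hg, hm]
    · simp [hg, hm]

/-- `good` ↔ good(p). [folklore] -/
theorem cellOf_good : (cellOf W p).good = true ↔ Good W p := by
  simp only [Cell.good, Bool.or_eq_true, cellOf, redOf, beq_iff_eq]
  by_cases hg : Good W p
  · by_cases hss : (p : ℤ) ∣ W.frobeniusTrace p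
    · simp [hg, hss]
    · simp [hg, hss]
  · by_cases hm : Mult W p
    · simp [hg, hm]
    · simp [hg, hm]

/-- `good = false` ↔ ¬good(p). [folklore] -/
theorem cellOf_good_false : (cellOf W p).good = false ↔ ¬ Good W p := by
  rw [Bool.eq_false_iff, ne_eq, cellOf_good]

omit [W.IsElliptic] [W.IsGloballyMinimal] in
/-- A good prime is not multiplicative (Mathlib `HasMultiplicativeReduction.not_hasGoodReduction`). [folklore] -/
theorem not_mult_of_good (hg : Good W p) : ¬ Mult W p := fun hm =>
  WeierstrassCurve.HasMultiplicativeReduction.not_hasGoodReduction (R := ℤ_[p]) hm hg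

/-- `mult` ↔ mult(p). [folklore] -/
theorem cellOf_mult : (cellOf W p).mult = true ↔ Mult W p := by
  simp only [Cell.mult, cellOf, redOf, beq_iff_eq]
  by_cases hg : Good W p
  · have hnm := not_mult_of_good W p hg
    by_cases hss : (p : ℤ) ∣ W.frobeniusTrace p
    · simp [hg, hss, hnm]
    · simp [hg, hss, hnm]
  · by_cases hm : Mult W p
    · simp [hg, hm]
    · simp [hg, hm]

/-- `addv` ↔ add(p). [folklore] -/
theorem cellOf_addv : (cellOf W p).addv = true ↔ Addv W p := by
  simp only [Cell.addv, cellOf, redOf, beq_iff_eq, Addv]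
  by_cases hg : Good W p
  · by_cases hss : (p : ℤ) ∣ W.frobeniusTrace p
    · simp [hg, hss]
    · simp [hg, hss]
  · by_cases hm : Mult W p
    · simp [hg, hm]
    · simp [hg, hm]

/-- `isRed` ↔ red(p). [folklore] -/
theorem cellOf_isRed : (cellOf W p).isRed = true ↔ Red W p := by
  simp only [Cell.isRed, cellOf, imOf, beq_iff_eq, Red]
  by_cases hi : Irr W p
  · by_cases hs : Surj W p
    · simp [hi, hs]
    · simp [hi, hs]
  · simp [hi]

/-- `irr` ↔ irr(p). [folklore] -/
theorem cellOf_irr : (cellOf W p).irr = true ↔ Irr W p := by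
  simp only [Cell.irr, cellOf, imOf, bne_iff_ne, ne_eq]
  by_cases hi : Irr W p
  · by_cases hs : Surj W p
    · simp [hi, hs]
    · simp [hi, hs]
  · simp [hi]

omit [W.IsGloballyMinimal] in
/-- A surjective mod-`p` image is irreducible (`hasIrreducibleModPGaloisRep_of_hasSurjectiveModNGaloisRep`). [folklore] -/
theorem irr_of_surj (hs : Surj W p) : Irr W p :=
  hasIrreducibleModPGaloisRep_of_hasSurjectiveModNGaloisRep W p hs

/-- `surj` ↔ surj(p) (a surjective image is irreducible). [folklore] -/
theorem cellOf_surj : (cellOf W p).surj = true ↔ Surj W p := by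
  simp only [Cell.surj, cellOf, imOf, beq_iff_eq]
  by_cases hi : Irr W p
  · by_cases hs : Surj W p
    · simp [hi, hs]
    · simp [hi, hs]
  · have hns : ¬ Surj W p := fun hs => hi (irr_of_surj W p hs)
    simp [hi, hns]

/-- `surj = false` ↔ ¬surj(p). [folklore] -/
theorem cellOf_surj_false : (cellOf W p).surj = false ↔ ¬ Surj W p := by
  rw [Bool.eq_false_iff, ne_eq, cellOf_surj]

/-- `smallIrr` ↔ irr(p) ∧ ¬surj(p). [folklore] -/
theorem cellOf_smallIrr : (cellOf W p).smallIrr = true ↔ Irr W p ∧ ¬ Surj W p := by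
  simp only [Cell.smallIrr, cellOf, imOf, beq_iff_eq]
  by_cases hi : Irr W p
  · by_cases hs : Surj W p
    · simp [hi, hs]
    · simp [hi, hs]
  · simp [hi]

/-- `r0` ↔ `r = 0`. [folklore] -/
theorem cellOf_r0 : (cellOf W p).r0 = true ↔ W.analyticRank = 0 := by
  simp only [Cell.r0, cellOf, rkOf, beq_iff_eq]
  by_cases h : W.analyticRank = 0
  · simp [h]
  · simp [h]

/-- `r1` ↔ `r ≠ 0`; under `r ≤ 1` this is `r = 1` (`cellOf_r1`). [folklore] -/
theorem cellOf_r1_iff_ne : (cellOf W p).r1 = true ↔ W.analyticRank ≠ 0 := by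
  simp only [Cell.r1, cellOf, rkOf, beq_iff_eq]
  by_cases h : W.analyticRank = 0
  · simp [h]
  · simp [h]

/-- `r1` ↔ `r = 1` when `r ≤ 1`. [folklore] -/
theorem cellOf_r1 (hr : W.analyticRank ≤ 1) : (cellOf W p).r1 = true ↔ W.analyticRank = 1 := by
  rw [cellOf_r1_iff_ne]; omega

/-- `r1 = false` ↔ `r ≠ 1` when `r ≤ 1`. [folklore] -/
theorem cellOf_r1_false (hr : W.analyticRank ≤ 1) :
    (cellOf W p).r1 = false ↔ ¬ W.analyticRank = 1 := by
  rw [Bool.eq_false_iff, ne_eq, cellOf_r1 W p hr]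

/-- `cm` ↔ CM. [folklore] -/
theorem cellOf_cm : (cellOf W p).cm = true ↔ W.HasCM := decide_eq_true_iff
/-- `cm = false` ↔ non-CM. [folklore] -/
theorem cellOf_cm_false : (cellOf W p).cm = false ↔ ¬ W.HasCM := decide_eq_false_iff_not
/-- `ram` ↔ ram(p). [folklore] -/
theorem cellOf_ram : (cellOf W p).ram = true ↔ Ram W p := decide_eq_true_iff
/-- `ram = false` ↔ ¬ram(p). [folklore] -/
theorem cellOf_ram_false : (cellOf W p).ram = false ↔ ¬ Ram W p := decide_eq_false_iff_not
/-- `sst` ↔ sst. [folklore] -/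
theorem cellOf_sst : (cellOf W p).sst = true ↔ Semistable W := decide_eq_true_iff
/-- `sst = false` ↔ ¬sst. [folklore] -/
theorem cellOf_sst_false : (cellOf W p).sst = false ↔ ¬ Semistable W := decide_eq_false_iff_not
/-- `anom` ↔ anom(p). [folklore] -/
theorem cellOf_anom : (cellOf W p).anom = true ↔ Anom W p := decide_eq_true_iff
/-- `anom = false` ↔ ¬anom(p). [folklore] -/
theorem cellOf_anom_false : (cellOf W p).anom = false ↔ ¬ Anom W p := decide_eq_false_iff_not
/-- `gvpar` ↔ gvpar(p). [folklore] -/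
theorem cellOf_gvpar : (cellOf W p).gvpar = true ↔ GVPar W p := decide_eq_true_iff
/-- `gvpar = false` ↔ ¬gvpar(p). [folklore] -/
theorem cellOf_gvpar_false : (cellOf W p).gvpar = false ↔ ¬ GVPar W p := decide_eq_false_iff_not
/-- `a3zero` ↔ `a_3 = 0`. [folklore] -/
theorem cellOf_a3zero : (cellOf W p).a3zero = true ↔ W.frobeniusTrace 3 = 0 := decide_eq_true_iff
/-- `a3zero = false` ↔ `a_3 ≠ 0`. [folklore] -/
theorem cellOf_a3zero_false : (cellOf W p).a3zero = false ↔ W.frobeniusTrace 3 ≠ 0 :=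
  decide_eq_false_iff_not
/-- `bigIm` ↔ (im). [folklore] -/
theorem cellOf_bigIm : (cellOf W p).bigIm = true ↔ BigIm W p := decide_eq_true_iff
/-- `bigIm = false` ↔ ¬(im). [folklore] -/
theorem cellOf_bigIm_false : (cellOf W p).bigIm = false ↔ ¬ BigIm W p := decide_eq_false_iff_not
/-- `cmSplit` ↔ `p` split in `K`. [folklore] -/
theorem cellOf_cmSplit : (cellOf W p).cmSplit = true ↔ CMSplit W p := decide_eq_true_iff
/-- `cmSplit = false` ↔ `p` not split in `K`. [folklore] -/
theorem cellOf_cmSplit_false : (cellOf W p).cmSplit = false ↔ ¬ CMSplit W p := decide_eq_false_iff_not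
/-- `cmRam` ↔ `p` ramified in `K`. [folklore] -/
theorem cellOf_cmRam : (cellOf W p).cmRam = true ↔ CMRamified W p := decide_eq_true_iff

/-- **The cell of a real pair is consistent**: anom ⇒ red ∧ ord (`goodOrd_of_anom`); red ∧ good ∧
`p > 2` ⇒ ord (`goodOrd_of_red_of_good`, Serre 1972 §1.11: at a supersingular prime `E[p]` is
irreducible); additive ⇒ not semistable; irr ∧ ¬surj ⇒ ¬(im) (`not_bigIm_of_irr_of_not_surj`).
[folklore] -/
theorem cellOf_consistent : (cellOf W p).consistent = true := by
  simp only [Cell.consistent, Bool.and_eq_true, Bool.or_eq_true, Bool.not_eq_true']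
  refine ⟨⟨⟨?_, ?_⟩, ?_⟩, ?_⟩
  · by_cases ha : Anom W p
    · exact Or.inr ⟨(cellOf_isRed W p).2 ha.1, (cellOf_goodOrd W p).2 (goodOrd_of_anom W p ha)⟩
    · exact Or.inl ((cellOf_anom_false W p).2 ha)
  · by_cases h : (Red W p ∧ p ≠ 2) ∧ Good W p
    · exact Or.inr ((cellOf_goodOrd W p).2
        (goodOrd_of_red_of_good W p ((prime_ne_two_iff p).1 h.1.2) h.2 h.1.1))
    · refine Or.inl ?_
      rw [Bool.eq_false_iff, ne_eq, Bool.and_eq_true, Bool.and_eq_true, cellOf_isRed, cellOf_odd,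
        cellOf_good]
      exact h
  · by_cases ha : Addv W p
    · refine Or.inr ((cellOf_sst_false W p).2 fun hs => ?_)
      rcases hs p (Fact.out : p.Prime) with hg | hm
      · exact ha.1 hg
      · exact ha.2 hm
    · refine Or.inl ?_
      rw [Bool.eq_false_iff, ne_eq, cellOf_addv]
      exact ha
  · by_cases hs : Irr W p ∧ ¬ Surj W p
    · exact Or.inr ((cellOf_bigIm_false W p).2 (not_bigIm_of_irr_of_not_surj W p hs.1 hs.2))
    · refine Or.inl ?_
      rw [Bool.eq_false_iff, ne_eq, cellOf_smallIrr]
      exact hs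

variable {W p}

/-- The tree's X9 is inside the printed X9 (`irr ∧ ¬surj ⇒ ¬(im)`, x9 seat's
`not_bigIm_of_irr_of_not_surj`). [folklore] -/
theorem ClassX9.toX9im (h : ClassX9 W p) : ClassX9im W p :=
  ⟨h.1, h.2.1, h.2.2.1, h.2.2.2.1, not_bigIm_of_irr_of_not_surj W p h.2.2.2.1 h.2.2.2.2.1, h.2.2.2.2.2⟩

omit [W.IsElliptic] in
/-- X11a is the rank-`0`, odd-`p`, no-(ram) part of the tree's X11. [folklore] -/
theorem ClassX11a.toX11 (h : ClassX11a W p) : ClassX11 W p := ⟨h.2.2.1, h.2.2.2.1, Or.inl h.2.2.2.2⟩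

omit [W.IsElliptic] in
/-- The rank-`1` part of the tree's X11 (odd `p`) is inside X11b. [folklore] -/
theorem ClassX11.toX11b (h : ClassX11 W p) (hr : W.analyticRank = 1) (hp : p ≠ 2) :
    ClassX11b W p := ⟨hr, hp, h.1, h.2.1⟩

end Curve

end Summit.BirchSwinnertonDyer.Rank1Residual
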